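import Summits.ResolutionOfSingularities.ResolutionOfSingularities.Theorems.FrobeniusClosingPatchingRelPerfectDepthSepFormat
import Summits.ResolutionOfSingularities.ResolutionOfSingularities.Theorems.FrobeniusClosingPatchingRelPerfectDepthMixedFormatBStepLemmas
import Summits.ResolutionOfSingularities.ResolutionOfSingularities.Theorems.FrobeniusClosingPatchingRelPerfectDepthMixedTower
import Literature.AlgebraicGeometry.Resolution.MonomialOrderReductionUnit
import Literature.AlgebraicGeometry.Resolution.MonomialMarkedIdealsBlowup
import Summits.ResolutionOfSingularities.ResolutionOfSingularities.Theorems.FrobeniusClosingPatchingRelPerfectDepthSNCJointMultiplicity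
import HarnessLib

/-!
# Chain W5.2 — F6 STAGE 2, lemmas for `SepFormat.step`: strict vs. controlled transform of a host of ORDER ONE,
# the strict transform of `E`, charged-list bookkeeping, coincidences off the centre

[OURS · L1 W5.2 · res-D-pv-016 AS res-L1-w52-stub-5, T6-X2 (res-L1-w52-plan-1 RULINGS 2026-08-27T09:17:34Z (3)); helper
file for `…DepthSepFormatStep.lean`.]  NOT a statement of the manuscript under review; AI-written, weaker than expert review;
fact-free.

* `strictTransformIdeal_eq_controlledTransform_one` — for an effective Cartier divisor `𝓐 ⊇ Ĉ` (scheme-theoretically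
  `𝓐 ≤ Ĉ`) of ORDER ONE at every point of the connected regular centre `V(Ĉ)` lying on an effective Cartier divisor, the
  strict transform is the weight-one controlled transform (res-D-pv-026's (L-A) `IsBlowup.strictTransformIdeal_eq_controlledTransform`
  with generic order `1`, after res-D-pv-052's `MixedStep.strictTransformIdeal_eq_controlledTransform_of_not_le`; the
  empty centre is allowed: both sides are then the total transform);
* `ker_eq_strictTransformIdeal_of_step` — along the dictionary square `i′ ≫ σ = τ ≫ i` of a regular pair the ideal of
  `E′` IS the strict transform of the ideal of `E` (`IsBlowup.hom_ext` + `IsBlowup.ker_strictTransformHom_of_isRegular` +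
  the previous lemma for `𝓐 = 𝓘_E`);
* `map_comap_boundaryOf_filter`, `boundaryOf_filter_strict_append` — the CHARGED sub-lists under traces and under one step;
* `stalkIdeal_comap_eq_of_coincidence_off_centre` — a coincidence of traces at a point of `E′` off the centre comes from one
  at the image point (the stalk map of a blowing up off its centre is an isomorphism).

## References
* J. Kollár, *Lectures on Resolution of Singularities* (2007), 3.30.2, Cor. 3.85. [Kollar2007]
* E. Bierstone, D. Grigoriev, P. Milman, J. Włodarczyk, arXiv:1206.3090, §3.2 Lemma 3.2.1, Def. 3.1.3 (4). [BierstoneGrigorievMilmanWlodarczyk2011]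
-/

-- `Summit.<Summit>.<Sub>.Theorems` with `Sub = Summit` (single-conjunct summit, D-0017)
set_option linter.dupNamespace false

noncomputable section

open CategoryTheory CategoryTheory.Limits AlgebraicGeometry TopologicalSpace IsLocalRing
open Literature.AlgebraicGeometry.Resolution
open Scheme.IdealSheafData

namespace Summit.ResolutionOfSingularities.ResolutionOfSingularities.Theorems

universe u

namespace DepthGraded

namespace SepStep

/-! ## §1 Strict = controlled transform for a host of order one along the centre -/

/-- [OURS · L1 W5.2] **The strict transform of an effective Cartier divisor of ORDER ONE along the centre is its
weight-one controlled transform.** `X` regular locally Noetherian with Noetherian space, `Ĉ` a regular centre with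
connected support contained in an effective Cartier divisor `H`, `𝓐` effective Cartier with `𝓐 ≤ Ĉ` and
`𝓐_y ⊄ 𝔪_y²` at every point `y` of `V(Ĉ)`; `σ` a blowing up along `Ĉ`. Then `strictTransformIdeal σ Ĉ 𝓐 = σᶜ(𝓐, 1)`:
the generic order of `𝓐` along `Ĉ` is `1` (res-D-pv-026's (L-A)); an empty centre is allowed (both sides are `σ^*𝓐`).
[cite: Kollar2007, 3.30.2] [cite: BierstoneGrigorievMilmanWlodarczyk2011, §3.2 Lemma 3.2.1] -/
theorem strictTransformIdeal_eq_controlledTransform_one {X X' : Scheme.{u}} [IsLocallyNoetherian X] [NoetherianSpace X]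
    (hX : Scheme.IsRegular X) {Ch H 𝓐 : X.IdealSheafData} (hCh : Scheme.IsRegular Ch.subscheme)
    (hconn : _root_.IsPreconnected (Ch.support : Set X)) (hH : IsEffectiveCartier H) (hHC : H ≤ Ch)
    (h𝓐 : IsEffectiveCartier 𝓐) (hle : 𝓐 ≤ Ch) {σ : X' ⟶ X} (hσ : IsBlowup σ Ch)
    (hord : ∀ y : X, y ∈ Ch.support → ¬ stalkIdeal 𝓐 y ≤ maximalIdeal (X.presheaf.stalk y) ^ 2) :
    strictTransformIdeal σ Ch 𝓐 = controlledTransform σ Ch 𝓐 1 := by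
  haveI : IsLocallyNoetherian X' := hσ.isLocallyNoetherian
  by_cases hne : (Ch.support : Set X).Nonempty
  · obtain ⟨η, hη⟩ := hCh.exists_isGenericPoint_support_of_isPreconnected hconn hne
    have hηC : η ∈ (Ch.support : Set X) := hη.mem
    have hint : interior (Ch.support : Set X) = ∅ :=
      interior_eq_empty_of_isGenericPoint_of_mem_support hη hH (Scheme.IdealSheafData.support_antitone hHC hηC)
    haveI : IsRegularLocalRing (X.presheaf.stalk η) := hX η
    -- the generic order is exactly one
    have hlow : ((1 : ℕ) : ℕ∞) ≤ idealOrder 𝓐 η := by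
      rw [le_idealOrder_iff, pow_one]
      exact (stalkIdeal_mono hle η).trans ((mem_support_iff_stalkIdeal_le Ch η).mp hηC)
    have hup : ¬ ((2 : ℕ) : ℕ∞) ≤ idealOrder 𝓐 η := by
      rw [le_idealOrder_iff]
      exact hord η hηC
    have hm : idealOrder 𝓐 η = (1 : ℕ) := by
      rcases eq_or_lt_of_le hlow with h | h
      · exact h.symm
      · exfalso
        apply hup
        have h2 := Order.add_one_le_of_lt h
        exact_mod_cast h2
    exact hσ.strictTransformIdeal_eq_controlledTransform hX hCh hη hint hm h𝓐
  · -- empty centre: the exceptional ideal is the unit ideal and both sides are the total transform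
    have hbot : (Ch.comap σ).support = ⊥ := by
      rw [Scheme.IdealSheafData.support_comap]
      ext x'
      simp only [Closeds.coe_preimage, Set.mem_preimage, Closeds.coe_bot, Set.mem_empty_iff_false, iff_false]
      exact fun h => hne ⟨_, h⟩
    have htop : Ch.comap σ = ⊤ := (Scheme.IdealSheafData.support_eq_bot_iff _).mp hbot
    have hct : controlledTransform σ Ch 𝓐 1 = 𝓐.comap σ := by
      rw [controlledTransform, htop, pow_one, colon_top]
    refine le_antisymm ?_ (controlledTransform_le_strictTransformIdeal σ Ch 𝓐 1)
    refine iSup_le fun n => ?_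
    rw [htop, ← Scheme.IdealSheafData.one_eq_top, one_pow, Scheme.IdealSheafData.one_eq_top, colon_top, hct]

/-! ## §2 The ideal of the strict transform of `E` -/

/-- [OURS · L1 W5.2] **`𝓘_{E′} = strictTransformIdeal σ Ĉ 𝓘_E`** along the dictionary square: `X` regular locally
Noetherian with Noetherian space, `E` regular, `i` a closed immersion with `ker i` an effective Cartier divisor, `C ⊆ E`
a regular centre with connected support, `σ` a blowing up along `Ĉ = C.map i`, `τ` one along `C`, `i′ ≫ σ = τ ≫ i`.
(`i′` IS the strict-transform morphism by the universal property; its ideal is `σᶜ(𝓘_E, 1)` by the regular-pair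
theorem; and `σᶜ(𝓘_E, 1)` is the strict transform ideal since `E` has order one along `Ĉ`.)
[cite: BierstoneGrigorievMilmanWlodarczyk2011, §4 Remark (3)] [cite: Kollar2007, 3.30.2] -/
theorem ker_eq_strictTransformIdeal_of_step {E X E' X' : Scheme.{u}} [IsLocallyNoetherian X] [NoetherianSpace X]
    {i : E ⟶ X} [IsClosedImmersion i] (hX : Scheme.IsRegular X) (hE : Scheme.IsRegular E)
    (hker : IsEffectiveCartier i.ker) {C : E.IdealSheafData} (hC : Scheme.IsRegular C.subscheme)
    (hconn : _root_.IsPreconnected (C.support : Set E))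
    {σ : X' ⟶ X} {τ : E' ⟶ E} (hσ : IsBlowup σ (C.map i)) (hτ : IsBlowup τ C) {i' : E' ⟶ X'}
    (hsq : i' ≫ σ = τ ≫ i) :
    i'.ker = strictTransformIdeal σ (C.map i) i.ker := by
  set Ch : X.IdealSheafData := C.map i with hCh
  have hkerCh : i.ker ≤ Ch := DepthOne.ker_le_map_centre i C
  have hChreg : Scheme.IsRegular Ch.subscheme := DepthOne.isRegular_subscheme_map i C hC
  have hτ' : IsBlowup τ (Ch.comap i) := by rw [hCh, DepthOne.comap_map_centre]; exact hτ
  have hi' : i' = hσ.strictTransformHom hτ' := by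
    apply hσ.hom_ext
    · rw [hsq, Scheme.IdealSheafData.comap_comp, hCh, DepthOne.comap_map_centre]
      exact hτ.isEffectiveCartier
    · rw [hsq, hσ.strictTransformHom_comp hτ']
  have hk : i'.ker = controlledTransform σ Ch i.ker 1 := by
    rw [hi']
    exact hσ.ker_strictTransformHom_of_isRegular hX hChreg hτ' hkerCh (DepthOne.isRegular_subscheme_ker i hE)
  rw [hk]
  symm
  -- `E` has order one at every point of the centre: the generator of `(ker i)_x` is a regular parameter
  refine strictTransformIdeal_eq_controlledTransform_one hX hChreg ?_ hker hkerCh hker hkerCh hσ fun y hy => ?_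
  · rw [hCh, coe_support_map_of_isClosedImmersion]
    exact hconn.image _ i.continuous.continuousOn
  · have hsnc : DepthSNC.SNCWithAt [i.ker] ⊤ y := (MixedFormatB.hasSNC_ker i hX hE hker).sncWithAt y
    have hyE : y ∈ i.ker.support := Scheme.IdealSheafData.support_antitone hkerCh hy
    exact hsnc.not_stalkIdeal_le_sq (List.mem_singleton_self _) hyE

/-! ## §3 Charged sub-lists under traces and under one step -/

/-- The traces of the X-side charged members are the E-side charged traces (filtering by the exponent commutes with
taking traces). [folklore] -/
theorem map_comap_boundaryOf_filter {E X : Scheme.{u}} (i : E ⟶ X) {𝒩 : List (X.IdealSheafData × ℕ)}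
    {𝒟 : List (E.IdealSheafData × ℕ)} (h𝒩 : 𝒩.map (fun p => (p.1.comap i, p.2)) = 𝒟) :
    (boundaryOf (𝒩.filter fun p => 0 < p.2)).map (fun G => G.comap i) =
      (𝒟.filter fun p => 0 < p.2).map Prod.fst := by
  subst h𝒩
  rw [List.filter_map, boundaryOf, List.map_map, List.map_map]
  rfl

/-- The charged members of the transformed list `𝒩.map (st × id) ++ [(F, e + 1)]` are the strict transforms of the
charged members followed by the (charged) new member `F`. [folklore] -/
theorem boundaryOf_filter_strict_append {X X' : Scheme.{u}} (st : X.IdealSheafData → X'.IdealSheafData)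
    (𝒩 : List (X.IdealSheafData × ℕ)) (F : X'.IdealSheafData) (e : ℕ) :
    boundaryOf ((𝒩.map (fun p => (st p.1, p.2)) ++ [(F, e + 1)]).filter fun p => 0 < p.2) =
      (boundaryOf (𝒩.filter fun p => 0 < p.2)).map st ++ [F] := by
  have h1 : ([(F, e + 1)] : List (X'.IdealSheafData × ℕ)).filter (fun p => 0 < p.2) = [(F, e + 1)] := by
    simp
  rw [List.filter_append, h1, List.filter_map, boundaryOf, boundaryOf, List.map_append, List.map_map, List.map_map,
    List.map_singleton]
  rfl

/-- Members of the charged sub-list are members of the boundary. [folklore] -/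
theorem mem_boundaryOf_of_mem_filter {X : Scheme.{u}} {𝒩 : List (X.IdealSheafData × ℕ)} {G : X.IdealSheafData}
    (hG : G ∈ boundaryOf (𝒩.filter fun p => 0 < p.2)) : G ∈ boundaryOf 𝒩 := by
  simp only [boundaryOf, List.mem_map, List.mem_filter] at hG ⊢
  obtain ⟨p, ⟨hp, -⟩, rfl⟩ := hG
  exact ⟨p, hp, rfl⟩

/-- Membership in the charged sub-list: some entry `(G, a)` with `a > 0`. [folklore] -/
theorem mem_boundaryOf_filter_iff {X : Scheme.{u}} {𝒩 : List (X.IdealSheafData × ℕ)} {G : X.IdealSheafData} :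
    G ∈ boundaryOf (𝒩.filter fun p => 0 < p.2) ↔ ∃ p ∈ 𝒩, 0 < p.2 ∧ p.1 = G := by
  simp only [boundaryOf, List.mem_map, List.mem_filter, decide_eq_true_eq]
  exact ⟨fun ⟨p, ⟨hp, hpos⟩, hG⟩ => ⟨p, hp, hpos, hG⟩, fun ⟨p, hp, hpos, hG⟩ => ⟨p, ⟨hp, hpos⟩, hG⟩⟩

/-! ## §4 Coincidences off the centre come from coincidences downstairs -/

/-- [OURS · L1 W5.2] **A coincidence of traces off the centre descends**: `τ` a blowing up of `E` along `C` (both locally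
Noetherian), `z′` a point with `τ z′ ∉ V(C)`; if the strict transform of `B` and the weight-`b` controlled transform of
`𝔟` have the same stalk at `z′`, then `B` and `𝔟` have the same stalk at `τ z′` (off the centre both stalks are the
images of the stalks downstairs under the stalk map, which is an isomorphism). [cite: Kollar2007, Def. 3.25]
[cite: StacksProject, Tag 02OS] -/
theorem stalkIdeal_eq_of_coincidence_off_centre {E E' : Scheme.{u}} [IsLocallyNoetherian E] [IsLocallyNoetherian E']
    {τ : E' ⟶ E} {C : E.IdealSheafData} (hτ : IsBlowup τ C) (B 𝔟 : E.IdealSheafData) (b : ℕ) {z' : E'}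
    (hz : τ.base z' ∉ C.support)
    (heq : stalkIdeal (strictTransformIdeal τ C B) z' = stalkIdeal (controlledTransform τ C 𝔟 b) z') :
    stalkIdeal B (τ.base z') = stalkIdeal 𝔟 (τ.base z') := by
  haveI := hτ.isIso_stalkMap_of_not_mem_support hz
  rw [stalkIdeal_strictTransformIdeal_of_not_mem_support C B hz,
    stalkIdeal_controlledTransform_of_not_mem_support 𝔟 b hz] at heq
  have hbij : Function.Bijective (τ.stalkMap z').hom := ConcreteCategory.bijective_of_isIso (τ.stalkMap z')
  have h := congrArg (Ideal.comap (τ.stalkMap z').hom) heq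
  rwa [Ideal.comap_map_of_bijective _ hbij, Ideal.comap_map_of_bijective _ hbij] at h

end SepStep

end DepthGraded

end Summit.ResolutionOfSingularities.ResolutionOfSingularities.Theorems

end
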